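import Literature.AlgebraicGeometry.Motives.StandardConjecturesHomNumProofs
import HarnessLib

/-!
# The standard conjecture of Lefschetz type is stable under products: `B(X) ∧ B(Z) ⇒ B(X × Z)`

S. Kleiman, *Algebraic cycles and the Weil conjectures* (1968), §2 (as cited by the tree's
`WeilCohomology.standardConjectureB_tensor_self`: Cor. 2.5, `B(X) ∧ B(Y) ⇒ B(X × Y)`, with the
independence of `B` from the polarisation; Kleiman 1994 Thm 4-1, Cor. 4-2; Murre 2004
§4.2.1.2 Remark 2 (a)): for a Weil cohomology theory `W` with the hard Lefschetz property, if
Grothendieck's standard conjecture of Lefschetz type holds in `θ`-form for `(X, η_X)` and for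
`(Z, η_Z)` (`X`, `Z` smooth projective of dimensions `n`, `m`, `η_X`, `η_Z` hyperplane classes),
then it holds for `(X × Z, η₂)` for **every** hyperplane class `η₂` of `X × Z`.

This file proves it (`WeilCohomology.standardConjectureB_tensor`), by the argument of the tree's
`standardConjectureB_tensor_self` (`Motives/StandardConjecturesHomNumProofs.lean`, the case
`Z = X`, `η_Z = η_X`) run with two different factors: Lieberman's Cayley–Hamilton trick. For
`i + r = n + m`, the hard-Lefschetz isomorphism `ℓ = L₂ʳ : Hⁱ(X × Z) → H^{2(n+m)-i}(X × Z)`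
of `η₂` and the algebraic isomorphism
`Φ = ⊕ ιₐ ⊠ ι_b : H^{2(n+m)-i}(X × Z) → Hⁱ(X × Z)` (`phiOp₂`; `ιₐ : Hᵃ(X) ⥲ H²ⁿ⁻ᵃ(X)` and
`ι_b : Hᵇ(Z) ⥲ H²ᵐ⁻ᵇ(Z)` the algebraic isomorphisms `iotaOp` supplied by `B(X, η_X)`,
`B(Z, η_Z)`) give an algebraic automorphism `g = Φ ∘ ℓ` of `Hⁱ(X × Z)` whose powers are
algebraic, hence have rational traces (Lefschetz trace formula,
`exists_rat_trace_of_isAlgebraicOperator`); by Cayley–Hamilton with rational coefficients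
(`LinearMap.exists_inverse_eq_sum_ratCast_smul_pow`) `g⁻¹ = ∑ qₖ gᵏ`, so `θ = g⁻¹ ∘ Φ` is
algebraic and inverse to `ℓ`. No Künneth projector of `X × Z` and no product polarisation is
needed; `η₂` is an arbitrary hyperplane class of the product.

Use: together with `B` for abelian varieties (Lieberman; the tree's
`standardConjectureB_abelianVariety`) this propagates `B` from generators to a product-stable
class of base pieces (`Motives/MotivatedCyclesModelledOn.lean`, `IsProdClosed`,
`motivatedClassesModelledOn_le_algebraicClasses_of_isProdClosed`), e.g. from abelian varieties
and compact abelian pencils to André's class of Thm. 0.6.2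
(`Motives/MotivatedCyclesAbelianPencilPieces.lean`): André 1996 §6.3 Remarque 2.

No new axioms, no named facts; the one-factor operators `iotaOp`, `iotaEquiv` and the two-factor
external tensor product `tensorOp` of `StandardConjecturesHomNumProofs` are reused as they are.

## References

* S. Kleiman, *Algebraic cycles and the Weil conjectures*, in: Dix exposés sur la cohomologie
  des schémas (1968), §2. [Kleiman1968AlgebraicCycles]
* J. P. Murre, *Lectures on motives* (2004), §4.2.1.2 Remark 2 (a). [Murre2004LecturesMotives]
* Y. André, *Pour une théorie inconditionnelle des motifs*, Publ. Math. IHÉS 83 (1996), §6.3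
  Remarque 2 (p. 33). [Andre1996Motifs]
-/

universe u v

open CategoryTheory AlgebraicGeometry MonoidalCategory CartesianMonoidalCategory
open scoped TensorProduct

noncomputable section

namespace Literature.AlgebraicGeometry.Motives

namespace WeilCohomology

variable {k : Type u} [Field k] {K : Type v} [Field K] [CharZero K] (W : WeilCohomology k K)

section BProduct₂

variable {n m : ℕ} {X Z : SchemeOver k} {ηX : W.obj X 2} {ηZ : W.obj Z 2}

/-- **The algebraic isomorphism `Φ : Hʲ(X × Z) → Hⁱ(X × Z)`**, `i + j = 2(n + m)`: on the Künneth
summand `Hᵃ(X) ⊗ Hᵇ(Z)` (`a + b = j`, `a ≤ 2n`, `b ≤ 2m`) it is `ιₐ ⊠ ι_b` into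
`H²ⁿ⁻ᵃ(X) ⊗ H²ᵐ⁻ᵇ(Z)`, with `ιₐ`, `ι_b` the algebraic isomorphisms `iotaOp` of `B(X, η_X)`,
`B(Z, η_Z)` (Kleiman 1968 §2, proof that `B(X) ∧ B(Z) ⇒ B(X × Z)`: the operators of `X × Z`
are tensor products of those of the factors). Two-factor version of `phiOp`. [cite: Kleiman1968AlgebraicCycles, §2] -/
def phiOp₂ (hX : IsSmoothProjective n X) (hZ : IsSmoothProjective m Z)
    (hBX : W.StandardConjectureB n X ηX) (hBZ : W.StandardConjectureB m Z ηZ) {i j : ℕ}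
    (hij : i + j = 2 * (n + m)) : W.obj (X ⊗ Z) j →ₗ[K] W.obj (X ⊗ Z) i :=
  ∑ p ∈ (Finset.antidiagonal j).attach,
    if hp : p.1.1 ≤ 2 * n ∧ p.1.2 ≤ 2 * m then
      W.tensorOp hX hZ (Finset.mem_antidiagonal.mp p.2)
        (show (2 * n - p.1.1) + (2 * m - p.1.2) = i by
          have := Finset.mem_antidiagonal.mp p.2; omega)
        (W.iotaOp hBX (show p.1.1 + (2 * n - p.1.1) = 2 * n by omega))
        (W.iotaOp hBZ (show p.1.2 + (2 * m - p.1.2) = 2 * m by omega))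
    else 0

/-- The (not necessarily algebraic) inverse `Ψ : Hⁱ(X × Z) → Hʲ(X × Z)` of `Φ`:
`ιₐ⁻¹ ⊠ ι_b⁻¹` on the summand `H²ⁿ⁻ᵃ(X) ⊗ H²ᵐ⁻ᵇ(Z)`. Two-factor version of `psiOp`. [folklore] -/
def psiOp₂ (hX : IsSmoothProjective n X) (hZ : IsSmoothProjective m Z)
    (hBX : W.StandardConjectureB n X ηX) (hBZ : W.StandardConjectureB m Z ηZ) {i j : ℕ}
    (hij : i + j = 2 * (n + m)) : W.obj (X ⊗ Z) i →ₗ[K] W.obj (X ⊗ Z) j :=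
  ∑ p ∈ (Finset.antidiagonal j).attach,
    if hp : p.1.1 ≤ 2 * n ∧ p.1.2 ≤ 2 * m then
      W.tensorOp hX hZ
        (show (2 * n - p.1.1) + (2 * m - p.1.2) = i by
          have := Finset.mem_antidiagonal.mp p.2; omega)
        (Finset.mem_antidiagonal.mp p.2)
        (W.iotaEquiv hBX (show p.1.1 + (2 * n - p.1.1) = 2 * n by omega)).symm.toLinearMap
        (W.iotaEquiv hBZ (show p.1.2 + (2 * m - p.1.2) = 2 * m by omega)).symm.toLinearMap
    else 0

/-- `Φ (x ⊠ z) = ιₐ x ⊠ ι_b z` for `x ∈ Hᵃ(X)`, `z ∈ Hᵇ(Z)`, `a ≤ 2n`, `b ≤ 2m`. [folklore] -/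
theorem phiOp₂_externalCup (hX : IsSmoothProjective n X) (hZ : IsSmoothProjective m Z)
    (hBX : W.StandardConjectureB n X ηX) (hBZ : W.StandardConjectureB m Z ηZ)
    {i j : ℕ} (hij : i + j = 2 * (n + m)) {a b : ℕ} (hab : a + b = j) (ha : a ≤ 2 * n)
    (hb : b ≤ 2 * m) (h₂ : (2 * n - a) + (2 * m - b) = i) (x : W.obj X a) (z : W.obj Z b) :
    W.phiOp₂ hX hZ hBX hBZ hij (W.externalCup X Z hab x z) =
      W.externalCup X Z h₂ (W.iotaOp hBX (show a + (2 * n - a) = 2 * n by omega) x)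
        (W.iotaOp hBZ (show b + (2 * m - b) = 2 * m by omega) z) := by
  classical
  unfold phiOp₂
  rw [LinearMap.sum_apply,
    Finset.sum_eq_single (⟨(a, b), Finset.mem_antidiagonal.mpr hab⟩ : ↥(Finset.antidiagonal j))]
  · dsimp only
    rw [dif_pos ⟨ha, hb⟩, W.tensorOp_externalCup_same hX hZ]
  · rintro ⟨⟨a₁, b₁⟩, hp⟩ - hne
    dsimp only
    split_ifs with hgood
    · apply W.tensorOp_externalCup_of_ne
      exact fun h ↦ hne (Subtype.ext (by simp only [Prod.mk.injEq]; exact ⟨h.1.symm, h.2.symm⟩))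
    · rfl
  · intro h
    exact absurd (Finset.mem_attach _ _) h

/-- `Ψ (Φ (x ⊠ z)) = x ⊠ z`. [folklore] -/
theorem psiOp₂_phiOp₂_externalCup (hX : IsSmoothProjective n X) (hZ : IsSmoothProjective m Z)
    (hBX : W.StandardConjectureB n X ηX) (hBZ : W.StandardConjectureB m Z ηZ)
    {i j : ℕ} (hij : i + j = 2 * (n + m)) {a b : ℕ} (hab : a + b = j) (x : W.obj X a)
    (z : W.obj Z b) :
    W.psiOp₂ hX hZ hBX hBZ hij (W.phiOp₂ hX hZ hBX hBZ hij (W.externalCup X Z hab x z)) =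
      W.externalCup X Z hab x z := by
  classical
  by_cases hgood : a ≤ 2 * n ∧ b ≤ 2 * m
  · obtain ⟨ha, hb⟩ := hgood
    have h₂ : (2 * n - a) + (2 * m - b) = i := by omega
    rw [W.phiOp₂_externalCup hX hZ hBX hBZ hij hab ha hb h₂]
    unfold psiOp₂
    rw [LinearMap.sum_apply,
      Finset.sum_eq_single (⟨(a, b), Finset.mem_antidiagonal.mpr hab⟩ : ↥(Finset.antidiagonal j))]
    · dsimp only
      rw [dif_pos ⟨ha, hb⟩, W.tensorOp_externalCup_same hX hZ]
      simp only [LinearEquiv.coe_coe]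
      have hx : (W.iotaEquiv hBX (show a + (2 * n - a) = 2 * n by omega)).symm
          (W.iotaOp hBX (show a + (2 * n - a) = 2 * n by omega) x) = x :=
        (W.iotaEquiv hBX _).symm_apply_apply x
      have hz : (W.iotaEquiv hBZ (show b + (2 * m - b) = 2 * m by omega)).symm
          (W.iotaOp hBZ (show b + (2 * m - b) = 2 * m by omega) z) = z :=
        (W.iotaEquiv hBZ _).symm_apply_apply z
      rw [hx, hz]
    · rintro ⟨⟨a₁, b₁⟩, hp⟩ - hne
      have hp' := Finset.mem_antidiagonal.mp hp
      dsimp only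
      split_ifs with hgood
      · apply W.tensorOp_externalCup_of_ne
        exact fun h ↦ hne (Subtype.ext (by simp only [Prod.mk.injEq]; omega))
      · rfl
    · intro h
      exact absurd (Finset.mem_attach _ _) h
  · have h0 : W.externalCup X Z hab x z = 0 := by
      rcases not_and_or.mp hgood with ha | hb
      · haveI := W.subsingleton_obj hX (i := a) (by omega)
        rw [Subsingleton.elim x 0, LinearMap.map_zero₂]
      · haveI := W.subsingleton_obj hZ (i := b) (by omega)
        rw [Subsingleton.elim z 0, map_zero]
    rw [h0, map_zero, map_zero]

/-- `Ψ ∘ Φ = id`. [folklore] -/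
theorem psiOp₂_comp_phiOp₂ (hX : IsSmoothProjective n X) (hZ : IsSmoothProjective m Z)
    (hBX : W.StandardConjectureB n X ηX) (hBZ : W.StandardConjectureB m Z ηZ)
    {i j : ℕ} (hij : i + j = 2 * (n + m)) :
    W.psiOp₂ hX hZ hBX hBZ hij ∘ₗ W.phiOp₂ hX hZ hBX hBZ hij = LinearMap.id := by
  ext w
  rw [LinearMap.comp_apply, LinearMap.id_apply]
  induction w using W.kunneth_induction hX hZ with
  | zero => rw [map_zero, map_zero]
  | add w w' hw hw' => rw [map_add, map_add, hw, hw']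
  | ext a b hab x z => exact W.psiOp₂_phiOp₂_externalCup hX hZ hBX hBZ hij hab x z

/-- `Φ` is injective. [folklore] -/
theorem phiOp₂_injective (hX : IsSmoothProjective n X) (hZ : IsSmoothProjective m Z)
    (hBX : W.StandardConjectureB n X ηX) (hBZ : W.StandardConjectureB m Z ηZ)
    {i j : ℕ} (hij : i + j = 2 * (n + m)) :
    Function.Injective (W.phiOp₂ hX hZ hBX hBZ hij) := by
  intro w w' h
  have := LinearMap.congr_fun (W.psiOp₂_comp_phiOp₂ hX hZ hBX hBZ hij) w
  have h' := LinearMap.congr_fun (W.psiOp₂_comp_phiOp₂ hX hZ hBX hBZ hij) w'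
  simp only [LinearMap.comp_apply, LinearMap.id_apply] at this h'
  rw [← this, ← h', h]

/-- **`Φ` is algebraic** (sum of external tensor products of the algebraic operators `ιₐ`,
`ι_b`: `isAlgebraicOperator_tensorOp`, `isAlgebraicOperator_iotaOp`). [cite: Kleiman1968AlgebraicCycles, §2] -/
theorem isAlgebraicOperator_phiOp₂ (hX : IsSmoothProjective n X) (hZ : IsSmoothProjective m Z)
    (hηX : W.IsHyperplaneClass X ηX) (hηZ : W.IsHyperplaneClass Z ηZ)
    (hBX : W.StandardConjectureB n X ηX) (hBZ : W.StandardConjectureB m Z ηZ) {i j : ℕ}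
    (hij : i + j = 2 * (n + m)) :
    W.IsAlgebraicOperator (n + m) (n + m) (W.phiOp₂ hX hZ hBX hBZ hij) := by
  unfold phiOp₂
  refine PreWeilCohomology.IsAlgebraicOperator.sum _ fun p _ ↦ ?_
  split_ifs with hp
  · exact W.isAlgebraicOperator_tensorOp hX hZ _ _ (W.isAlgebraicOperator_iotaOp hX hηX hBX _)
      (W.isAlgebraicOperator_iotaOp hZ hηZ hBZ _)
  · exact W.isAlgebraicOperator_zero

/-- **`B(X, η_X) ∧ B(Z, η_Z) ⇒ B(X × Z, η₂)` for every hyperplane class `η₂` on `X × Z`**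
(Kleiman 1968 §2 — `B(X) ∧ B(Y) ⇒ B(X × Y)` together with the independence of `B` from the
polarisation, as cited by the tree's `standardConjectureB_tensor_self`; Murre 2004 §4.2.1.2
Remark 2 (a)). Under hard Lefschetz, if `B` holds in `θ`-form for `(X, η_X)` and `(Z, η_Z)`,
`X`, `Z` smooth projective of dimensions `n`, `m`, then it holds in `θ`-form for `(X × Z, η₂)`.

Proof (Lieberman's Cayley–Hamilton argument, exactly as in `standardConjectureB_tensor_self`):
for `i + r = n + m`, the hard-Lefschetz isomorphism `ℓ = L₂ʳ : Hⁱ(X × Z) → H^{i+2r}(X × Z)` of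
`η₂` and the algebraic isomorphism `Φ = ⊕ ιₐ ⊠ ι_b` (`phiOp₂`) give an algebraic automorphism
`g = Φ ∘ ℓ` of `Hⁱ(X × Z)`, all of whose powers are algebraic, hence have rational traces
(`exists_rat_trace_of_isAlgebraicOperator`); by Cayley–Hamilton with rational coefficients
(`LinearMap.exists_inverse_eq_sum_ratCast_smul_pow`) `g⁻¹ = ∑ qₖ gᵏ`, so
`θ = g⁻¹ ∘ Φ = ∑ qₖ (gᵏ ∘ Φ)` is algebraic and inverse to `ℓ`.

Depends only on: the hypothesis `W.HasHardLefschetz` (for `(X × Z, η₂)`), `finite_obj`,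
`isAlgebraicOperator_tensorOp`, `isAlgebraicOperator_iotaOp` (hence
`standardConjectureC_of_standardConjectureB_holds` and `IsAlgebraicOperator.comp_lefschetzPow`
on the factors), `IsAlgebraicOperator.comp`, `exists_rat_trace_of_isAlgebraicOperator` and their
listed dependencies. [cite: Kleiman1968AlgebraicCycles, §2] [cite: Murre2004LecturesMotives, §4.2.1.2 Remark 2(a)] -/
theorem standardConjectureB_tensor (hL : W.HasHardLefschetz) (hX : IsSmoothProjective n X)
    (hZ : IsSmoothProjective m Z) (hηX : W.IsHyperplaneClass X ηX)
    (hηZ : W.IsHyperplaneClass Z ηZ) (hBX : W.StandardConjectureB n X ηX)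
    (hBZ : W.StandardConjectureB m Z ηZ) {η₂ : W.obj (X ⊗ Z) 2}
    (hη₂ : W.IsHyperplaneClass (X ⊗ Z) η₂) : W.StandardConjectureB (n + m) (X ⊗ Z) η₂ := by
  classical
  intro i r j hir hij
  have hY := IsSmoothProjective.tensor_holds hX hZ
  haveI : FiniteDimensional K (W.obj (X ⊗ Z) i) := W.finite_obj hY i
  have hij' : i + j = 2 * (n + m) := by omega
  set ℓ := W.lefschetzPow (X ⊗ Z) η₂ r i j hij with hℓ_def
  have hℓ : Function.Bijective ℓ := hL hY η₂ hη₂ i r j hir hij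
  set Φ := W.phiOp₂ hX hZ hBX hBZ hij' with hΦ_def
  have hΦalg : W.IsAlgebraicOperator (n + m) (n + m) Φ :=
    W.isAlgebraicOperator_phiOp₂ hX hZ hηX hηZ hBX hBZ hij'
  set g : Module.End K (W.obj (X ⊗ Z) i) := Φ ∘ₗ ℓ with hg_def
  -- `g` is algebraic
  have hgalg : W.IsAlgebraicOperator (n + m) (n + m) g := hΦalg.comp_lefschetzPow hY hY hη₂ hij
  -- `g` is invertible
  have hgbij : Function.Bijective g := by
    have hinj : Function.Injective g := (W.phiOp₂_injective hX hZ hBX hBZ hij').comp hℓ.1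
    exact ⟨hinj, LinearMap.injective_iff_surjective.mp hinj⟩
  have hunit : IsUnit g := (Module.End.isUnit_iff g).mpr hgbij
  -- the powers of `g` are algebraic, hence have rational traces
  have hpow : ∀ e : ℕ, W.IsAlgebraicOperator (n + m) (n + m) (g ^ (e + 1)) := by
    intro e
    induction e with
    | zero => simpa using hgalg
    | succ e ih =>
      rw [pow_succ, Module.End.mul_eq_comp]
      exact PreWeilCohomology.IsAlgebraicOperator.comp hY hY hY ih hgalg
  have htr : ∀ e : ℕ, ∃ q : ℚ, LinearMap.trace K _ (g ^ (e + 1)) = q :=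
    fun e ↦ W.exists_rat_trace_of_isAlgebraicOperator hY (hpow e)
  -- Cayley–Hamilton with rational coefficients
  obtain ⟨q, hq, -⟩ := LinearMap.exists_inverse_eq_sum_ratCast_smul_pow g hunit htr
  set P : Module.End K (W.obj (X ⊗ Z) i) :=
    ∑ e ∈ Finset.range (Module.finrank K (W.obj (X ⊗ Z) i)), ((q e : ℚ) : K) • g ^ e with hP_def
  refine ⟨P ∘ₗ Φ, ⟨hir, ?_, ?_⟩, ?_⟩
  · -- `θ ∘ ℓ = id`
    rw [LinearMap.comp_assoc, ← hg_def, ← Module.End.mul_eq_comp, hq, Module.End.one_eq_id]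
  · -- `ℓ ∘ θ = id`
    have h₁ : (P ∘ₗ Φ) ∘ₗ ℓ = LinearMap.id := by
      rw [LinearMap.comp_assoc, ← hg_def, ← Module.End.mul_eq_comp, hq, Module.End.one_eq_id]
    refine LinearMap.ext fun y ↦ ?_
    obtain ⟨x, rfl⟩ := hℓ.2 y
    have := LinearMap.congr_fun h₁ x
    simp only [LinearMap.comp_apply, LinearMap.id_apply] at this ⊢
    rw [this]
  · -- algebraicity of `θ = ∑ qₖ (gᵏ ∘ Φ)`
    have hpow' : ∀ e : ℕ, W.IsAlgebraicOperator (n + m) (n + m) ((g ^ e) ∘ₗ Φ) := by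
      intro e
      induction e with
      | zero =>
        rw [pow_zero, Module.End.one_eq_id, LinearMap.id_comp]
        exact hΦalg
      | succ e ih =>
        rw [pow_succ', Module.End.mul_eq_comp, LinearMap.comp_assoc]
        exact PreWeilCohomology.IsAlgebraicOperator.comp hY hY hY hgalg ih
    have hPΦ : P ∘ₗ Φ = ∑ e ∈ Finset.range (Module.finrank K (W.obj (X ⊗ Z) i)),
        ((q e : ℚ) : K) • ((g ^ e) ∘ₗ Φ) := by
      ext x
      simp [hP_def, LinearMap.sum_apply]
    rw [hPΦ]
    refine PreWeilCohomology.IsAlgebraicOperator.sum _ fun e _ ↦ ?_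
    exact PreWeilCohomology.IsAlgebraicOperator.ratCast_smul (hpow' e) (q e)

/-- **`B` passes to products, polarisation-free form**: under hard Lefschetz, if `B` (`θ`-form)
holds for every hyperplane class of `X` and of `Z` (smooth projective of positive dimensions
`n`, `m`, so that hyperplane classes exist, `isHyperplaneClass_nonempty`), then `B` holds for
every hyperplane class of `X × Z`. The form consumed when propagating `B` along a
product-stable class of base pieces (`IsProdClosed`, `Motives/MotivatedCyclesModelledOn.lean`).
[cite: Kleiman1968AlgebraicCycles, §2] -/
theorem standardConjectureB_tensor_of_forall (hL : W.HasHardLefschetz) (hX : IsSmoothProjective n X)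
    (hZ : IsSmoothProjective m Z) (hn : 1 ≤ n) (hm : 1 ≤ m)
    (hBX : ∀ ⦃η : W.obj X 2⦄, W.IsHyperplaneClass X η → W.StandardConjectureB n X η)
    (hBZ : ∀ ⦃η : W.obj Z 2⦄, W.IsHyperplaneClass Z η → W.StandardConjectureB m Z η)
    {η₂ : W.obj (X ⊗ Z) 2} (hη₂ : W.IsHyperplaneClass (X ⊗ Z) η₂) :
    W.StandardConjectureB (n + m) (X ⊗ Z) η₂ := by
  obtain ⟨ηX, hηX⟩ := W.isHyperplaneClass_nonempty hX hn
  obtain ⟨ηZ, hηZ⟩ := W.isHyperplaneClass_nonempty hZ hm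
  exact W.standardConjectureB_tensor hL hX hZ hηX hηZ (hBX hηX) (hBZ hηZ) hη₂

end BProduct₂

end WeilCohomology

end Literature.AlgebraicGeometry.Motives

end
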